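import Mathlib.Analysis.SpecialFunctions.Trigonometric.Bounds
import Summits.HubbardSuperconductivity.HubbardSuperconductivity.Theorems.ThermalWedgeTwSeededEnsembleEquivalenceRFreeColdEdgeReduction

/-!
# Crux `TwSeededEnsembleEquivalenceR` (stmt-HubbardSuperconductivity-15581), line `cold-floor-collapse`
# (slug `Sketch`) — F2 `stub_freeDensityBandBottom`: the free BdG density is small near the band bottom

Support file (`--supports stmt-HubbardSuperconductivity-15581`; sorry-free; no definition). It proves the
registered free-gas stub `stub_freeDensityBandBottom` of skeleton v4: the Brillouin-zone average
`N(β,μ,h) = (1/4π²)∫₀^{2π}∫₀^{2π} [1 − (ξ/E) tanh(βE/2)] dθ₂ dθ₁` (`ξ = −2(cos θ₁ + cos θ₂) − μ`,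
`E² = ξ² + 8h²(cos θ₁ − cos θ₂)²`) of the free (`U = 0`) `d`-wave BdG density satisfies `N ≤ 1/10` for
`β ≥ 200`, `|h| ≤ 10⁻³` and `μ ∈ [−4, −197/50]` (just above the band bottom; numerically `N ≈ 0.01`).

Proof (crude but rigorous). Per mode, for `ξ > 0`: `1 − (ξ/E)t = (1 − t) + t(1 − ξ/E) ≤ 2e^{−βξ} + D/(2ξ²)`
(`t = tanh(βE/2)`, `1 − tanh(y/2) ≤ 2e^{−y}`, `1 − ξ/E = D/(E(E+ξ))`), and always `n ≤ 2`. With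
`a = 1 − cos θ₁`, `b = 1 − cos θ₂`: if `a + b ≥ 3/50` then `ξ ≥ max(3/50, a + b)`, so
`n ≤ 2e^{−12} + 4h² ≤ 1/2000`; otherwise `a, b < 3/50`. Hence pointwise
`n ≤ 1/2000 + 2·χ(θ₁)χ(θ₂)`, `χ = 1{1 − cos θ < 3/50}`, and by Jordan's inequality
`cos θ ≤ 1 − (2/π²)θ²` on `[−π, π]` the level set has `∫₀^{2π} χ ≤ π√3/5`; integrating twice,
`N ≤ 1/2000 + 2·(π√3/5)²/(4π²) = 1/2000 + 3/50 < 1/10`.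
[folklore: BdG mean-field thermodynamics]
-/

set_option linter.dupNamespace false

namespace Summit.HubbardSuperconductivity.HubbardSuperconductivity.Theorems.TwSeededEnsembleEquivalenceR.ColdFloorLine

open Real MeasureTheory intervalIntegral

/-! ### Per-mode bounds for the BdG density `1 − (z/E) tanh(βE/2)`, `E = √(z² + d)` -/

/-- `1 − tanh(y/2) ≤ 2e^{−y}` (indeed `1 − tanh(y/2) = 2e^{−y}/(1 + e^{−y})`). [folklore] -/
theorem fdb_one_sub_tanh_half_le (y : ℝ) : 1 - Real.tanh (y / 2) ≤ 2 * Real.exp (-y) := by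
  rw [Real.tanh_eq]
  have hp : 0 < Real.exp (y / 2) := Real.exp_pos _
  have hq : 0 < Real.exp (-(y / 2)) := Real.exp_pos _
  have hpq : Real.exp (y / 2) * Real.exp (-(y / 2)) = 1 := by
    rw [← Real.exp_add, add_neg_cancel, Real.exp_zero]
  have hqq : Real.exp (-y) = Real.exp (-(y / 2)) * Real.exp (-(y / 2)) := by
    rw [← Real.exp_add]; congr 1; ring
  have hne : Real.exp (y / 2) + Real.exp (-(y / 2)) ≠ 0 := (add_pos hp hq).ne'
  have e : 1 - (Real.exp (y / 2) - Real.exp (-(y / 2))) / (Real.exp (y / 2) + Real.exp (-(y / 2))) =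
      2 * Real.exp (-(y / 2)) / (Real.exp (y / 2) + Real.exp (-(y / 2))) := by
    field_simp; ring
  rw [e, hqq, div_le_iff₀ (add_pos hp hq)]
  have h3 : Real.exp (-(y / 2)) * Real.exp (-(y / 2)) * Real.exp (y / 2) = Real.exp (-(y / 2)) := by
    rw [mul_assoc, mul_comm (Real.exp (-(y / 2))) (Real.exp (y / 2)), hpq, mul_one]
  nlinarith [h3, pow_pos hq 3]

/-- The BdG density is at most `2`: `1 − (z/E) tanh(βE/2) ≤ 2` since `|z/E| ≤ 1` and `|tanh| ≤ 1` (and the guarded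
value at `E = 0` is `1`). [folklore] -/
theorem fdb_bdgDensity_le_two (β z d : ℝ) (hd : 0 ≤ d) :
    1 - (if z ^ 2 + d = 0 then (0:ℝ) else z / Real.sqrt (z ^ 2 + d) * Real.tanh (β * Real.sqrt (z ^ 2 + d) / 2)) ≤ 2 := by
  split_ifs with h
  · norm_num
  · have hE : 0 < Real.sqrt (z ^ 2 + d) := Real.sqrt_pos.2 (lt_of_le_of_ne (by positivity) (Ne.symm h))
    have h1 : |z / Real.sqrt (z ^ 2 + d)| ≤ 1 := by
      rw [abs_div, abs_of_pos hE, div_le_one hE]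
      exact Real.abs_le_sqrt (by linarith)
    have h2 : |Real.tanh (β * Real.sqrt (z ^ 2 + d) / 2)| ≤ 1 := (Real.abs_tanh_lt_one _).le
    have h3 : |z / Real.sqrt (z ^ 2 + d) * Real.tanh (β * Real.sqrt (z ^ 2 + d) / 2)| ≤ 1 := by
      rw [abs_mul]; exact mul_le_one₀ h1 (abs_nonneg _) h2
    linarith [neg_abs_le (z / Real.sqrt (z ^ 2 + d) * Real.tanh (β * Real.sqrt (z ^ 2 + d) / 2))]

/-- For `z > 0` (`β > 0`, `d ≥ 0`, `E = √(z² + d) ≥ z`):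
`1 − (z/E) tanh(βE/2) = (1 − t) + t(1 − z/E) ≤ 2e^{−βE} + (E − z)/E ≤ 2e^{−βz} + d/(2z²)`. [folklore] -/
theorem fdb_bdgDensity_le_of_pos {β z d : ℝ} (hβ : 0 < β) (hz : 0 < z) (hd : 0 ≤ d) :
    1 - (if z ^ 2 + d = 0 then (0:ℝ) else z / Real.sqrt (z ^ 2 + d) * Real.tanh (β * Real.sqrt (z ^ 2 + d) / 2)) ≤
      2 * Real.exp (-(β * z)) + d / (2 * z ^ 2) := by
  have hzd : z ^ 2 + d ≠ 0 := by positivity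
  rw [if_neg hzd]
  have hE : 0 < Real.sqrt (z ^ 2 + d) := Real.sqrt_pos.2 (by positivity)
  have hE0 : Real.sqrt (z ^ 2 + d) ≠ 0 := hE.ne'
  have hE2 : Real.sqrt (z ^ 2 + d) ^ 2 = z ^ 2 + d := Real.sq_sqrt (by positivity)
  have hE3 : Real.sqrt (z ^ 2 + d) ^ 3 = (z ^ 2 + d) * Real.sqrt (z ^ 2 + d) := by rw [pow_succ, hE2]
  have hzE : z ≤ Real.sqrt (z ^ 2 + d) := Real.le_sqrt_of_sq_le (by linarith)
  have ht1 : Real.tanh (β * Real.sqrt (z ^ 2 + d) / 2) ≤ 1 := (Real.tanh_lt_one _).le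
  have h1t := fdb_one_sub_tanh_half_le (β * Real.sqrt (z ^ 2 + d))
  have hexp : Real.exp (-(β * Real.sqrt (z ^ 2 + d))) ≤ Real.exp (-(β * z)) :=
    Real.exp_le_exp.2 (by nlinarith [mul_le_mul_of_nonneg_left hzE hβ.le])
  have h1zE : 0 ≤ 1 - z / Real.sqrt (z ^ 2 + d) := by
    rw [sub_nonneg, div_le_one hE]; exact hzE
  have hkey : 1 - z / Real.sqrt (z ^ 2 + d) ≤ d / (2 * z ^ 2) := by
    have e : 1 - z / Real.sqrt (z ^ 2 + d) = (Real.sqrt (z ^ 2 + d) - z) / Real.sqrt (z ^ 2 + d) := by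
      field_simp
    rw [e, div_le_div_iff₀ hE (by positivity)]
    nlinarith [mul_nonneg (mul_nonneg (sub_nonneg.2 hzE) (sub_nonneg.2 hzE))
      (by positivity : (0:ℝ) ≤ Real.sqrt (z ^ 2 + d) + 2 * z)]
  have hsplit : 1 - z / Real.sqrt (z ^ 2 + d) * Real.tanh (β * Real.sqrt (z ^ 2 + d) / 2) =
      (1 - Real.tanh (β * Real.sqrt (z ^ 2 + d) / 2)) +
        Real.tanh (β * Real.sqrt (z ^ 2 + d) / 2) * (1 - z / Real.sqrt (z ^ 2 + d)) := by ring
  have hA : Real.tanh (β * Real.sqrt (z ^ 2 + d) / 2) * (1 - z / Real.sqrt (z ^ 2 + d)) ≤ d / (2 * z ^ 2) :=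
    (mul_le_of_le_one_left h1zE ht1).trans hkey
  rw [hsplit]
  linarith

/-! ### Pointwise bound on the torus near the band bottom -/

/-- **Pointwise bound near the band bottom.** For `β ≥ 200`, `|h| ≤ 10⁻³`, `μ ∈ [−4, −197/50]` and all `θ`:
`n(θ) ≤ 1/2000 + 2·χ(θ₁)χ(θ₂)` with `χ(θ) = 1{1 − cos θ < 3/50}`. If `a + b ≥ 3/50` (`a = 1 − cos θ₁`,
`b = 1 − cos θ₂`) then `ξ = 2(a+b) − 4 − μ ≥ max(3/50, a + b) > 0`, `D = 8h²(a − b)² ≤ 8h²ξ²`, so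
`n ≤ 2e^{−βξ} + D/(2ξ²) ≤ 2e^{−12} + 4h² ≤ 2/4096 + 4·10⁻⁶ ≤ 1/2000` (`e ≥ 2`); otherwise `a, b < 3/50`,
`χ(θ₁) = χ(θ₂) = 1` and `n ≤ 2`. [folklore] -/
theorem fdb_bdgDensity_pointwise {β h μ : ℝ} (hβ : 200 ≤ β) (hh : |h| ≤ 1 / 1000)
    (hμ : μ ∈ Set.Icc (-4 : ℝ) (-(197 / 50))) (θ₁ θ₂ : ℝ) :
    (1 - (if (-2 * (Real.cos θ₁ + Real.cos θ₂) - μ) ^ 2 + (2 * Real.sqrt 2 * h * (Real.cos θ₁ - Real.cos θ₂)) ^ 2 = 0 then (0:ℝ) else (-2 * (Real.cos θ₁ + Real.cos θ₂) - μ) / Real.sqrt ((-2 * (Real.cos θ₁ + Real.cos θ₂) - μ) ^ 2 + (2 * Real.sqrt 2 * h * (Real.cos θ₁ - Real.cos θ₂)) ^ 2) * Real.tanh (β * Real.sqrt ((-2 * (Real.cos θ₁ + Real.cos θ₂) - μ) ^ 2 + (2 * Real.sqrt 2 * h * (Real.cos θ₁ - Real.cos θ₂)) ^ 2) / 2)))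 ≤
      1 / 2000 + 2 * (if 1 - Real.cos θ₁ < 3 / 50 then (1:ℝ) else 0) * (if 1 - Real.cos θ₂ < 3 / 50 then (1:ℝ) else 0) := by
  have hβ0 : 0 < β := by linarith
  have hsq2 : Real.sqrt 2 ^ 2 = 2 := Real.sq_sqrt (by norm_num)
  have hc1 := Real.cos_le_one θ₁
  have hc2 := Real.cos_le_one θ₂
  generalize hd_def : (2 * Real.sqrt 2 * h * (Real.cos θ₁ - Real.cos θ₂)) ^ 2 = d
  generalize hz : -2 * (Real.cos θ₁ + Real.cos θ₂) - μ = z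
  have hd : 0 ≤ d := by rw [← hd_def]; positivity
  have hd8 : d = 8 * h ^ 2 * (Real.cos θ₁ - Real.cos θ₂) ^ 2 := by
    rw [← hd_def, mul_pow, mul_pow, mul_pow, hsq2]; ring
  by_cases hab : 3 / 50 ≤ (1 - Real.cos θ₁) + (1 - Real.cos θ₂)
  · -- main region: `ξ = z ≥ max(3/50, a + b)`
    have hz1 : 3 / 50 ≤ z := by linarith [hμ.2]
    have hz2 : (1 - Real.cos θ₁) + (1 - Real.cos θ₂) ≤ z := by linarith [hμ.2]
    have hzpos : 0 < z := by linarith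
    have hmain := fdb_bdgDensity_le_of_pos hβ0 hzpos hd
    -- `e^{-βz} ≤ e^{-12} ≤ 2^{-12}`
    have h4096 : (4096:ℝ) ≤ Real.exp 12 := by
      have h1 : (2:ℝ) ≤ Real.exp 1 := by linarith [Real.add_one_le_exp (1:ℝ)]
      have h3 : Real.exp 1 ^ 12 = Real.exp 12 := by rw [← Real.exp_nat_mul]; norm_num
      calc (4096:ℝ) = 2 ^ 12 := by norm_num
        _ ≤ Real.exp 1 ^ 12 := pow_le_pow_left₀ (by norm_num) h1 12
        _ = Real.exp 12 := h3
    have hexp : Real.exp (-(β * z)) ≤ 1 / 4096 := by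
      have h12 : Real.exp (-(β * z)) ≤ Real.exp (-12) := Real.exp_le_exp.2 (by nlinarith)
      refine h12.trans ?_
      rw [Real.exp_neg, one_div]
      exact inv_anti₀ (by norm_num) h4096
    -- `D/(2ξ²) ≤ 4h² ≤ 4·10⁻⁶`
    have hcz : |Real.cos θ₁ - Real.cos θ₂| ≤ z := by
      rw [abs_le]; constructor <;> linarith
    have hΔ : (Real.cos θ₁ - Real.cos θ₂) ^ 2 ≤ z ^ 2 := by
      rw [← sq_abs (Real.cos θ₁ - Real.cos θ₂)]
      exact pow_le_pow_left₀ (abs_nonneg _) hcz 2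
    have hfrac : d / (2 * z ^ 2) ≤ 4 * h ^ 2 := by
      rw [div_le_iff₀ (by positivity), hd8]
      nlinarith [mul_le_mul_of_nonneg_left hΔ (sq_nonneg h)]
    have hh2 : h ^ 2 ≤ (1 / 1000) ^ 2 := by
      rw [← sq_abs h]; exact pow_le_pow_left₀ (abs_nonneg h) hh 2
    have hprod : 0 ≤ 2 * (if 1 - Real.cos θ₁ < 3 / 50 then (1:ℝ) else 0) * (if 1 - Real.cos θ₂ < 3 / 50 then (1:ℝ) else 0) := by
      positivity
    linarith
  · -- corner region: both `a, b < 3/50`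
    rw [not_le] at hab
    have ha : 1 - Real.cos θ₁ < 3 / 50 := by linarith
    have hb : 1 - Real.cos θ₂ < 3 / 50 := by linarith
    rw [if_pos ha, if_pos hb]
    have := fdb_bdgDensity_le_two β z d hd
    linarith

/-! ### The level set `{1 − cos θ < 3/50}` and integration of the pointwise bound -/

/-- The level-set indicator `χ(θ) = 1{1 − cos θ < 3/50}` is interval integrable (measurable, bounded by `1`).
[folklore] -/
theorem fdb_chi_intervalIntegrable (a b : ℝ) :
    IntervalIntegrable (fun θ : ℝ => if 1 - Real.cos θ < 3 / 50 then (1:ℝ) else 0) volume a b := by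
  have hmeas : Measurable (fun θ : ℝ => if 1 - Real.cos θ < 3 / 50 then (1:ℝ) else 0) :=
    Measurable.ite (measurableSet_lt (continuous_const.sub Real.continuous_cos).measurable measurable_const)
      measurable_const measurable_const
  refine (intervalIntegrable_const (c := (1:ℝ))).mono_fun' hmeas.aestronglyMeasurable
    (Filter.Eventually.of_forall fun θ => ?_)
  beta_reduce
  split_ifs <;> simp

/-- **1-D level-set bound**: `∫₀^{2π} 1{1 − cos θ < 3/50} dθ ≤ π√3/5 = 2c`, `c = π√3/10` (`(2/π²)c² = 3/50`): by
Jordan's inequality `cos θ ≤ 1 − (2/π²)θ²` on `[−π, π]` (applied to `θ` resp. `θ − 2π`) the integrand vanishes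
on `[c, 2π − c]`, and it is at most `1` on the two end intervals of length `c`. [folklore] -/
theorem fdb_integral_chi_le :
    ∫ θ in (0:ℝ)..2 * π, (if 1 - Real.cos θ < 3 / 50 then (1:ℝ) else 0) ≤ π * Real.sqrt 3 / 5 := by
  have hπ : 0 < π := Real.pi_pos
  have hs3 : Real.sqrt 3 ^ 2 = 3 := Real.sq_sqrt (by norm_num)
  have hs3' : Real.sqrt 3 < 2 := by
    rw [Real.sqrt_lt' (by norm_num : (0:ℝ) < 2)]; norm_num
  have hc0 : 0 ≤ π * Real.sqrt 3 / 10 := by positivity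
  have hcπ : π * Real.sqrt 3 / 10 ≤ π := by nlinarith
  have hc2 : 2 / π ^ 2 * (π * Real.sqrt 3 / 10) ^ 2 = 3 / 50 := by
    rw [div_pow, mul_pow, hs3, div_mul_eq_mul_div, div_eq_iff (by positivity)]; ring
  -- the integrand vanishes on the middle interval
  have hzero : ∀ θ ∈ Set.uIcc (π * Real.sqrt 3 / 10) (2 * π - π * Real.sqrt 3 / 10),
      (if 1 - Real.cos θ < 3 / 50 then (1:ℝ) else 0) = 0 := by
    intro θ hθ
    rw [Set.uIcc_of_le (by linarith)] at hθ
    obtain ⟨hθ1, hθ2⟩ := hθ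
    have hge : 3 / 50 ≤ 1 - Real.cos θ := by
      rcases le_or_gt θ π with h1 | h1
      · have hj := Real.cos_le_one_sub_mul_cos_sq (x := θ) (by rw [abs_of_nonneg (hc0.trans hθ1)]; exact h1)
        have h2 : (π * Real.sqrt 3 / 10) ^ 2 ≤ θ ^ 2 := pow_le_pow_left₀ hc0 hθ1 2
        have h3 : 2 / π ^ 2 * (π * Real.sqrt 3 / 10) ^ 2 ≤ 2 / π ^ 2 * θ ^ 2 :=
          mul_le_mul_of_nonneg_left h2 (by positivity)
        linarith
      · have hj := Real.cos_le_one_sub_mul_cos_sq (x := θ - 2 * π)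
          (by rw [abs_of_nonpos (by linarith [hθ2])]; linarith)
        rw [Real.cos_sub_two_pi] at hj
        have h2 : (π * Real.sqrt 3 / 10) ^ 2 ≤ (θ - 2 * π) ^ 2 := by
          nlinarith [mul_nonneg (sub_nonneg.2 hθ2) (by linarith [hθ2] : (0:ℝ) ≤ 2 * π - θ + π * Real.sqrt 3 / 10)]
        have h3 : 2 / π ^ 2 * (π * Real.sqrt 3 / 10) ^ 2 ≤ 2 / π ^ 2 * (θ - 2 * π) ^ 2 :=
          mul_le_mul_of_nonneg_left h2 (by positivity)
        linarith
    rw [if_neg (not_lt.2 hge)]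
  -- crude bound `∫ᵤᵛ χ ≤ |v - u|`
  have hb : ∀ u v : ℝ, ∫ θ in u..v, (if 1 - Real.cos θ < 3 / 50 then (1:ℝ) else 0) ≤ |v - u| := by
    intro u v
    have := intervalIntegral.norm_integral_le_of_norm_le_const (a := u) (b := v) (C := 1)
      (f := fun θ => if 1 - Real.cos θ < 3 / 50 then (1:ℝ) else 0) (fun θ _ => by split_ifs <;> simp)
    rw [Real.norm_eq_abs, one_mul] at this
    exact (le_abs_self _).trans this
  have hI := fdb_chi_intervalIntegrable
  rw [← integral_add_adjacent_intervals (hI 0 (π * Real.sqrt 3 / 10)) (hI (π * Real.sqrt 3 / 10) (2 * π)),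
    ← integral_add_adjacent_intervals (hI (π * Real.sqrt 3 / 10) (2 * π - π * Real.sqrt 3 / 10))
      (hI (2 * π - π * Real.sqrt 3 / 10) (2 * π)),
    intervalIntegral.integral_congr hzero, intervalIntegral.integral_zero]
  have h1 := hb 0 (π * Real.sqrt 3 / 10)
  have h2 := hb (2 * π - π * Real.sqrt 3 / 10) (2 * π)
  rw [sub_zero, abs_of_nonneg hc0] at h1
  rw [show 2 * π - (2 * π - π * Real.sqrt 3 / 10) = π * Real.sqrt 3 / 10 by ring, abs_of_nonneg hc0] at h2
  linarith

/-- Integration of a pointwise bound `f ≤ A + B·χ` over `[0, 2π]` (`B ≥ 0`, `χ = 1{1 − cos θ < 3/50}`):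
`∫₀^{2π} f ≤ 2πA + B·π√3/5`. [folklore] -/
theorem fdb_integral_le_of_le_chi {f : ℝ → ℝ} {A B : ℝ} (hf : IntervalIntegrable f volume 0 (2 * π)) (hB : 0 ≤ B)
    (hle : ∀ θ ∈ Set.Icc 0 (2 * π), f θ ≤ A + B * (if 1 - Real.cos θ < 3 / 50 then (1:ℝ) else 0)) :
    ∫ θ in (0:ℝ)..2 * π, f θ ≤ 2 * π * A + B * (π * Real.sqrt 3 / 5) := by
  have hI := fdb_chi_intervalIntegrable 0 (2 * π)
  have hIB : IntervalIntegrable (fun θ : ℝ => B * (if 1 - Real.cos θ < 3 / 50 then (1:ℝ) else 0)) volume 0 (2 * π) :=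
    hI.const_mul B
  have hIA : IntervalIntegrable (fun _ : ℝ => A) volume 0 (2 * π) := intervalIntegrable_const
  have hIAB : IntervalIntegrable (fun θ : ℝ => A + B * (if 1 - Real.cos θ < 3 / 50 then (1:ℝ) else 0)) volume 0 (2 * π) :=
    hIA.add hIB
  calc ∫ θ in (0:ℝ)..2 * π, f θ
      ≤ ∫ θ in (0:ℝ)..2 * π, (A + B * (if 1 - Real.cos θ < 3 / 50 then (1:ℝ) else 0)) :=
        intervalIntegral.integral_mono_on (by positivity) hf hIAB hle
    _ = 2 * π * A + B * ∫ θ in (0:ℝ)..2 * π, (if 1 - Real.cos θ < 3 / 50 then (1:ℝ) else 0) := by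
        rw [intervalIntegral.integral_add hIA hIB, intervalIntegral.integral_const, intervalIntegral.integral_const_mul]
        simp only [sub_zero, smul_eq_mul]
    _ ≤ 2 * π * A + B * (π * Real.sqrt 3 / 5) := by
        have := mul_le_mul_of_nonneg_left fdb_integral_chi_le hB
        linarith

/-! ### F2 -/

/-- **F2 `stub_freeDensityBandBottom`** (registered stub of crux `TwSeededEnsembleEquivalenceR`, line `Sketch`): near
the band bottom the Brillouin-zone average of the free `d`-wave BdG density is small,
`N(β,μ,h) = (1/4π²)∫₀^{2π}∫₀^{2π} [1 − (ξ/E) tanh(βE/2)] dθ₂ dθ₁ ≤ 1/10` for `β ≥ 200`, `|h| ≤ 10⁻³`,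
`μ ∈ [−4, −197/50]`: integrate the pointwise bound `n ≤ 1/2000 + 2χ(θ₁)χ(θ₂)` twice (inner integrand continuous by
`cfl_continuous_bdgDensity`, outer by the parametric interval integral) and use `∫χ ≤ π√3/5`:
`N ≤ 1/2000 + 3/50 < 1/10`. [folklore: BdG mean-field thermodynamics] -/
theorem stub_freeDensityBandBottom : ∀ (β h μ : ℝ), 200 ≤ β → |h| ≤ 1 / 1000 → μ ∈ Set.Icc (-4 : ℝ) (-(197 / 50)) → ((∫ θ₁ in (0 : ℝ)..2 * π, ∫ θ₂ in (0 : ℝ)..2 * π, (1 - (if (-2 * (Real.cos θ₁ + Real.cos θ₂) - μ) ^ 2 + (2 * Real.sqrt 2 * h * (Real.cos θ₁ - Real.cos θ₂)) ^ 2 = 0 then (0:ℝ) else (-2 * (Real.cos θ₁ + Real.cos θ₂) - μ) / Real.sqrt ((-2 * (Real.cos θ₁ + Real.cos θ₂) - μ) ^ 2 + (2 * Real.sqrt 2 * h * (Real.cos θ₁ - Real.cos θ₂)) ^ 2) * Real.tanh (β * Real.sqrt ((-2 * (Real.cos θ₁ + Real.cos θ₂) - μ) ^ 2 + (2 * Real.sqrt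 2 * h * (Real.cos θ₁ - Real.cos θ₂)) ^ 2) / 2)))) / (4 * π ^ 2)) ≤ 1 / 10 := by
  intro β h μ hβ hh hμ
  have hβ0 : 0 < β := by linarith
  have hcont := cfl_continuous_bdgDensity β μ h hβ0
  have hinner : ∀ θ₁ : ℝ, ∫ θ₂ in (0 : ℝ)..2 * π, (1 - (if (-2 * (Real.cos θ₁ + Real.cos θ₂) - μ) ^ 2 + (2 * Real.sqrt 2 * h * (Real.cos θ₁ - Real.cos θ₂)) ^ 2 = 0 then (0:ℝ) else (-2 * (Real.cos θ₁ + Real.cos θ₂) - μ) / Real.sqrt ((-2 * (Real.cos θ₁ + Real.cos θ₂) - μ) ^ 2 + (2 * Real.sqrt 2 * h * (Real.cos θ₁ - Real.cos θ₂)) ^ 2) * Real.tanh (β * Real.sqrt ((-2 * (Real.cos θ₁ + Real.cos θ₂) - μ) ^ 2 + (2 * Real.sqrt 2 * h * (Real.cos θ₁ - Real.cos θ₂)) ^ 2) / 2))) ≤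
      2 * π * (1 / 2000) + 2 * (if 1 - Real.cos θ₁ < 3 / 50 then (1:ℝ) else 0) * (π * Real.sqrt 3 / 5) := fun θ₁ =>
    fdb_integral_le_of_le_chi ((hcont.uncurry_left θ₁).intervalIntegrable _ _) (by positivity)
      fun θ₂ _ => fdb_bdgDensity_pointwise hβ hh hμ θ₁ θ₂
  have houter : ∫ θ₁ in (0 : ℝ)..2 * π, ∫ θ₂ in (0 : ℝ)..2 * π, (1 - (if (-2 * (Real.cos θ₁ + Real.cos θ₂) - μ) ^ 2 + (2 * Real.sqrt 2 * h * (Real.cos θ₁ - Real.cos θ₂)) ^ 2 = 0 then (0:ℝ) else (-2 * (Real.cos θ₁ + Real.cos θ₂) - μ) / Real.sqrt ((-2 * (Real.cos θ₁ + Real.cos θ₂) - μ) ^ 2 + (2 * Real.sqrt 2 * h * (Real.cos θ₁ - Real.cos θ₂)) ^ 2) * Real.tanh (β * Real.sqrt ((-2 * (Real.cos θ₁ + Real.cos θ₂) - μ) ^ 2 + (2 * Real.sqrt 2 * h * (Real.cos θ₁ - Real.cos θ₂)) ^ 2) / 2))) ≤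
      2 * π * (2 * π * (1 / 2000)) + 2 * (π * Real.sqrt 3 / 5) * (π * Real.sqrt 3 / 5) :=
    fdb_integral_le_of_le_chi
      ((intervalIntegral.continuous_parametric_intervalIntegral_of_continuous' hcont 0 (2 * π)).intervalIntegrable _ _)
      (by positivity) fun θ₁ _ => (hinner θ₁).trans_eq (by ring)
  have hs3 : Real.sqrt 3 ^ 2 = 3 := Real.sq_sqrt (by norm_num)
  have hRHS : 2 * π * (2 * π * (1 / 2000)) + 2 * (π * Real.sqrt 3 / 5) * (π * Real.sqrt 3 / 5) = π ^ 2 * (121 / 500) := by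
    rw [show 2 * π * (2 * π * (1 / 2000)) + 2 * (π * Real.sqrt 3 / 5) * (π * Real.sqrt 3 / 5) =
      π ^ 2 * (1 / 500) + π ^ 2 * Real.sqrt 3 ^ 2 * (2 / 25) by ring, hs3]
    ring
  rw [hRHS] at houter
  rw [div_le_iff₀ (by positivity)]
  have hπ2 : 0 < π ^ 2 := by positivity
  nlinarith [houter, hπ2]

end Summit.HubbardSuperconductivity.HubbardSuperconductivity.Theorems.TwSeededEnsembleEquivalenceR.ColdFloorLine
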